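import Mathlib
import Summits.NavierStokesRegularity.NavierStokesRegularity.Theorems.TaoLadderRungTwoBreakCircuitTableDefs
import Summits.NavierStokesRegularity.NavierStokesRegularity.Theorems.TaoLadderRungTwoBreakOneShiftFrameRows
import HarnessLib

/-!
# The absolute row sums `Σ_{i₁,i₂,μ} |α_{i₁i₂iμ}|` of the circuit table

The table-sparse rate function of the one-shift Banach chain (`exists_surviving_dssWave_of_windowCert_v5s/_v7s`)
is pinned with a constant `S ≥ tableAbsSum α i` for every component `i`.  For the four-mode circuit table
`circuitTable ρ p q g k` (…CircuitTableDefs) these row sums are `|ρ|+|p|+|q|+|k|`, `|p|+|g|`, `|q|+|g|`, `|ρ|+|k|`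
(components `0,1,2,3`); e.g. for the cell's T4 table `(ρ,p,q,g,k) = (1, 0.326, 0.134, 0.375, 0.618)` the
maximum is `S = 2.078` (component `0`).  Model lattice only; nothing about Navier–Stokes.
[cite: Tao2016AveragedNS, §4 (4.1)–(4.3), §6 (the circuit); cell vocabulary, harvest/h2-tao-ladder
rung1/num4c/v7s_check.py (S_i), rung1/INSTANCE-SHEET-T4-0.1-W76.md]
-/

noncomputable section

namespace Summit.NavierStokesRegularity.NavierStokesRegularity.Theorems

namespace DSSOneShift

open Literature.Analysis.FluidPDE Literature.Analysis.FluidPDE.TaoCascade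

namespace OneShiftFrame

/-- **Absolute row sums of the circuit table**, per receiving component: `(|ρ|+|p|+|q|+|k|, |p|+|g|, |q|+|g|, |ρ|+|k|)`.
[cite: Tao2016AveragedNS, §4 (4.1), §6; cell vocabulary, harvest/h2-tao-ladder rung1/num4c/v7s_check.py] -/
theorem tableAbsSum_circuitTable (ρ p q g k : ℝ) :
    tableAbsSum (circuitTable ρ p q g k) 0 = |ρ| + |p| + |q| + |k| ∧
    tableAbsSum (circuitTable ρ p q g k) 1 = |p| + |g| ∧
    tableAbsSum (circuitTable ρ p q g k) 2 = |q| + |g| ∧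
    tableAbsSum (circuitTable ρ p q g k) 3 = |ρ| + |k| := by
  have hS : ∀ f : ℤ × ℤ × ℤ → ℝ,
      ∑ μ ∈ shiftSet, f μ = f (0, 0, 0) + f (1, 0, 0) + f (0, 1, 0) + f (0, 0, 1) := by
    intro f
    simp [shiftSet, Finset.sum_insert, add_assoc]
  simp only [tableAbsSum, hS, Fin.sum_univ_four]
  simp (config := { decide := true }) only [circuitTable, if_true, if_false, abs_zero, add_zero, zero_add,
    true_and, abs_neg, abs_div, abs_two]
  exact ⟨by ring, by ring, by ring⟩

end OneShiftFrame

end DSSOneShift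

end Summit.NavierStokesRegularity.NavierStokesRegularity.Theorems
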